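import Mathlib
import Literature.NumberTheory.LFunctions.Zhang2022.Section12WindowAbelBV
import Literature.NumberTheory.Sieve.MontgomeryVaughan1975GaussSums
import HarnessLib

/-!
# Short-window hyperbola bound for a Dirichlet convolution of two character-twisted
# bounded-variation sequences (the `χ`-window lemma behind (D5″)(d)(iii), Leg A of the
# long/short leg split of Zhang (2022) §7 (7.18)–(7.21))

Topic `Literature/NumberTheory/LFunctions/Zhang2022` (Landau–Siegel audit tree; verdict-neutral).
Y. Zhang, *Discrete mean estimates and the Landau–Siegel zero*, arXiv:2211.02515v1 (2022)
[Zhang2022LandauSiegel] — **an unrefereed manuscript under adjudication; nothing here asserts or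
denies its Theorems 1–2.** Cell landau-siegel, desk note `ls-ref-1/D5d-iii-DUAL-v1.md` §2, critic
read ls-knife-crit-1 2026-08-27T17:21:01Z (p4): the STRUCTURE hypothesis of a re-typed Leg-A long
slot must be discharged by an elementary kernel lemma. This file is that lemma, THEOREMS ONLY:

* §A (combinatorics, [folklore]) the window hyperbola identity
  `Σ_{N<n≤M} Σ_{uv=n} φ(u,v) = Σ_{1≤u≤M} Σ_{N/u<v≤M/u} φ(u,v)` (integer divisions) and its split
  at a parameter `U ≤ M`: `u ≤ U` summed with `v` inside, `u > U` re-summed with `v ≤ M/(U+1)`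
  outside and `max(U, N/v) < u ≤ M/v` inside (`sum_window_conv_eq_sum_pairs`,
  `sum_pairs_eq_sum_fst`, `sum_pairs_tail_eq_sum_snd`, `sum_window_conv_split`; the finset
  bookkeeping lemmas are private);
* §B (the abstract bounds) `norm_window_conv_le_l1`: `‖Σ_{N<uv≤M} a(u)c(v)‖ ≤ ‖a‖_{ℓ¹[1,M]}·C`
  when the window sums of `c` (right end `≤ M`) are `≤ C` (how an `ℓ¹`-head passes a window bound
  through); and the hyperbola form: if ALL window sums of `f` are `≤ A`, all window sums of `g` are `≤ B`,
  `‖f‖ ≤ S_f`, `‖g‖ ≤ S_g`, then for every window `(N, M]` and every `U ≤ M`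
  `‖Σ_{N<uv≤M} f(u)g(v)‖ ≤ U·S_f·B + ⌊M/(U+1)⌋·S_g·A` (`norm_window_conv_le`), hence with
  `U = ⌊√M⌋`: `≤ √M·(S_f·B + S_g·A)` (`norm_window_conv_le_sqrt`) — uniform in the position `N`
  and the length `M − N` of the window (no lower bound on the length is needed); ALL hypotheses
  are local to `n ≤ M` (window sums with right end `≤ M`, sup and variation on `[1, M]`);
* §C (the character instance) for `χ` primitive mod `D ≥ 2` and complex weights `G`, `F` with
  `‖G‖ ≤ S_G`, `‖F‖ ≤ S_F` and total variation `≤ V_G`, `≤ V_F` on every window, the tree's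
  Pólya–Vinogradov + Abel bound (`WindowAbelBV.norm_sum_Ioc_chi_mul_le_of_sup_tv`) feeds §B with
  `A = √D(1+log D)(S_G+V_G)`, `B = √D(1+log D)(S_F+V_F)`:
  `‖Σ_{N<uv≤M} χ(u)G(u)χ(v)F(v)‖ ≤ √M·√D(1+log D)·(S_G(S_F+V_F) + S_F(S_G+V_G))`
  `≤ 2√M·√D(1+log D)·(S_G+V_G)(S_F+V_F)` (`norm_window_chi_conv_le`, `norm_window_chi_conv_le'`);
* §D (the side condition) with `(uv, k) = 1`, `k ≥ 1`, inside the sum — the slot shape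
  `ChiWindowBound` of the cell's record — the same bound times `τ(k) = #divisors(k)`:
  Möbius inversion of `(n,k) = 1` and Pólya–Vinogradov on each progression give
  `‖Σ_{N<n≤M,(n,k)=1} χ(n)‖ ≤ τ(k)√D(1+log D)` (`norm_window_chi_coprime_le`), the condition
  `(uv,k) = 1` factors as `(u,k) = 1 ∧ (v,k) = 1`, and §B applies
  (`norm_window_chi_conv_coprime_le`).

The saving against the trivial bound `(M−N)·S_G·S_F·(divisor count)` is `√M·√D log D/(M−N)`,
generated by `Σ_{n mod D} χ(n) = 0` (through Pólya–Vinogradov); no zero-free region, no Siegel-type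
hypothesis, no `t₀/ε₁` input. In the cell's use (`x = t₀pk/l₁ ≥ √P`, `h = 2x𝓛^{−114}`) this is the
bound `E_A ≪ D^{O(1)}𝓛^{O(1)}kP^{3/4}` of the desk note, immaterial against `P^{−1/4}`.

## References

* Y. Zhang, arXiv:2211.02515v1 (2022), §7 Prop. 7.1, (7.18)–(7.21) p. 15.
  [cite: Zhang2022LandauSiegel, §7 (7.18)–(7.21) p. 15]
* H. L. Montgomery, R. C. Vaughan, *Multiplicative Number Theory I*, CUP 2007, §1.3 Thm. 1.3
  (Abel summation), §2.1 (the hyperbola method), §9.4 Thm. 9.18 (Pólya–Vinogradov).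
  [cite: MontgomeryVaughan2007, §1.3, §2.1, §9.4]
-/

noncomputable section

open Finset

namespace Literature.NumberTheory.LFunctions.Zhang2022.WindowHyperbola

/-! ### §A. The window hyperbola identity (combinatorics) -/

/-- For `N < n ≤ M`, the factorisations `(u,v)` of `n` are exactly the pairs `1 ≤ u,v ≤ M` with
`N < uv ≤ M` and `uv = n`. [folklore] -/
private theorem divisorsAntidiagonal_eq_filter {N M n : ℕ} (hn : n ∈ Ioc N M) :
    n.divisorsAntidiagonal =
      ((Ioc 0 M ×ˢ Ioc 0 M).filter
          (fun p : ℕ × ℕ => N < p.1 * p.2 ∧ p.1 * p.2 ≤ M)).filter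
        (fun p : ℕ × ℕ => p.1 * p.2 = n) := by
  rw [Finset.mem_Ioc] at hn
  ext ⟨u, v⟩
  simp only [Nat.mem_divisorsAntidiagonal, Finset.mem_filter, Finset.mem_product,
    Finset.mem_Ioc]
  constructor
  · rintro ⟨huv, hn0⟩
    have hu : 0 < u := Nat.pos_of_ne_zero (by rintro rfl; simp at huv; omega)
    have hv : 0 < v := Nat.pos_of_ne_zero (by rintro rfl; simp at huv; omega)
    have huM : u ≤ M := (Nat.le_mul_of_pos_right u hv).trans (by omega)
    have hvM : v ≤ M := (Nat.le_mul_of_pos_left v hu).trans (by omega)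
    exact ⟨⟨⟨⟨hu, huM⟩, ⟨hv, hvM⟩⟩, by omega, by omega⟩, huv⟩
  · rintro ⟨⟨-, -⟩, huv⟩
    exact ⟨huv, by omega⟩

/-- **Window hyperbola identity, pair form**:
`Σ_{N<n≤M} Σ_{uv=n} φ(u,v) = Σ_{(u,v) : 1≤u,v≤M, N<uv≤M} φ(u,v)`.
[cite: MontgomeryVaughan2007, §2.1 (hyperbola method)] -/
theorem sum_window_conv_eq_sum_pairs {E : Type*} [AddCommMonoid E] (φ : ℕ × ℕ → E) (N M : ℕ) :
    ∑ n ∈ Ioc N M, ∑ p ∈ n.divisorsAntidiagonal, φ p =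
      ∑ p ∈ (Ioc 0 M ×ˢ Ioc 0 M).filter
          (fun p : ℕ × ℕ => N < p.1 * p.2 ∧ p.1 * p.2 ≤ M), φ p := by
  rw [← Finset.sum_fiberwise_of_maps_to (t := Ioc N M) (g := fun p : ℕ × ℕ => p.1 * p.2)
    (fun p hp => by
      simp only [Finset.mem_filter] at hp
      exact Finset.mem_Ioc.mpr hp.2)]
  refine Finset.sum_congr rfl fun n hn => ?_
  rw [divisorsAntidiagonal_eq_filter hn]

/-- For `u ≥ 1`: `{1 ≤ v ≤ M : N < uv ≤ M} = (N/u, M/u]` (integer divisions). [folklore] -/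
private theorem filter_snd_eq_Ioc {N M u : ℕ} (hu : 0 < u) :
    (Ioc 0 M).filter (fun v => N < u * v ∧ u * v ≤ M) = Ioc (N / u) (M / u) := by
  ext v
  simp only [Finset.mem_filter, Finset.mem_Ioc, Nat.div_lt_iff_lt_mul hu,
    Nat.le_div_iff_mul_le hu]
  constructor
  · rintro ⟨-, hN, hM⟩
    exact ⟨by rwa [mul_comm] at hN, by rwa [mul_comm] at hM⟩
  · rintro ⟨hN, hM⟩
    have hv : 0 < v := Nat.pos_of_ne_zero (by rintro rfl; simp at hN)
    refine ⟨⟨hv, (Nat.le_mul_of_pos_right v hu).trans hM⟩, ?_, ?_⟩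
    · rwa [mul_comm] at hN
    · rwa [mul_comm] at hM

/-- For `v ≥ 1`: `{U < u ≤ M : N < uv ≤ M} = (max(U, N/v), M/v]`. [folklore] -/
private theorem filter_fst_eq_Ioc {N M U v : ℕ} (hv : 0 < v) :
    (Ioc U M).filter (fun u => N < u * v ∧ u * v ≤ M) = Ioc (max U (N / v)) (M / v) := by
  ext u
  simp only [Finset.mem_filter, Finset.mem_Ioc, max_lt_iff, Nat.div_lt_iff_lt_mul hv,
    Nat.le_div_iff_mul_le hv]
  constructor
  · rintro ⟨⟨hU, -⟩, hN, hM⟩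
    exact ⟨⟨hU, hN⟩, hM⟩
  · rintro ⟨⟨hU, hN⟩, hM⟩
    exact ⟨⟨hU, (Nat.le_mul_of_pos_right u hv).trans hM⟩, hN, hM⟩

/-- **Window hyperbola identity, `u`-first form**:
`Σ_{(u,v)} φ(u,v) = Σ_{1≤u≤M} Σ_{N/u<v≤M/u} φ(u,v)`.
[cite: MontgomeryVaughan2007, §2.1 (hyperbola method)] -/
theorem sum_pairs_eq_sum_fst {E : Type*} [AddCommMonoid E] (φ : ℕ × ℕ → E) (N M : ℕ) :
    ∑ p ∈ (Ioc 0 M ×ˢ Ioc 0 M).filter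
        (fun p : ℕ × ℕ => N < p.1 * p.2 ∧ p.1 * p.2 ≤ M), φ p =
      ∑ u ∈ Ioc 0 M, ∑ v ∈ Ioc (N / u) (M / u), φ (u, v) := by
  rw [Finset.sum_filter, Finset.sum_product]
  refine Finset.sum_congr rfl fun u hu => ?_
  have hu0 : 0 < u := (Finset.mem_Ioc.mp hu).1
  rw [← Finset.sum_filter, filter_snd_eq_Ioc hu0]

/-- **The tail `u > U` re-summed with `v` outside**: for `U ≤ M`,
`Σ_{U<u≤M} Σ_{N/u<v≤M/u} φ(u,v) = Σ_{1≤v≤M/(U+1)} Σ_{max(U,N/v)<u≤M/v} φ(u,v)`.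
[cite: MontgomeryVaughan2007, §2.1 (hyperbola method)] -/
theorem sum_pairs_tail_eq_sum_snd {E : Type*} [AddCommMonoid E] (φ : ℕ × ℕ → E) (N M U : ℕ) :
    ∑ u ∈ Ioc U M, ∑ v ∈ Ioc (N / u) (M / u), φ (u, v) =
      ∑ v ∈ Ioc 0 (M / (U + 1)), ∑ u ∈ Ioc (max U (N / v)) (M / v), φ (u, v) := by
  -- both sides equal the sum over the pairs `(u,v) ∈ (U,M] × (0,M]` with `N < uv ≤ M`
  have h1 : ∑ u ∈ Ioc U M, ∑ v ∈ Ioc (N / u) (M / u), φ (u, v) =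
      ∑ p ∈ (Ioc U M ×ˢ Ioc 0 M).filter
        (fun p : ℕ × ℕ => N < p.1 * p.2 ∧ p.1 * p.2 ≤ M), φ p := by
    rw [Finset.sum_filter, Finset.sum_product]
    refine Finset.sum_congr rfl fun u hu => ?_
    have hu0 : 0 < u := by have := (Finset.mem_Ioc.mp hu).1; omega
    rw [← Finset.sum_filter, filter_snd_eq_Ioc hu0]
  have h2 : ∑ p ∈ (Ioc U M ×ˢ Ioc 0 M).filter
        (fun p : ℕ × ℕ => N < p.1 * p.2 ∧ p.1 * p.2 ≤ M), φ p =
      ∑ v ∈ Ioc 0 M, ∑ u ∈ Ioc (max U (N / v)) (M / v), φ (u, v) := by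
    rw [Finset.sum_filter, Finset.sum_product_right]
    refine Finset.sum_congr rfl fun v hv => ?_
    have hv0 : 0 < v := (Finset.mem_Ioc.mp hv).1
    rw [← Finset.sum_filter, filter_fst_eq_Ioc hv0]
  rw [h1, h2]
  symm
  refine Finset.sum_subset (fun v hv => ?_) (fun v hv hv' => ?_)
  · rw [Finset.mem_Ioc] at hv ⊢
    exact ⟨hv.1, hv.2.trans (Nat.div_le_self M (U + 1))⟩
  · rw [Finset.mem_Ioc] at hv
    rw [Finset.mem_Ioc, not_and, not_le] at hv'
    have hv0 : 0 < v := hv.1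
    have hlt : M / (U + 1) < v := hv' hv0
    rw [Nat.div_lt_iff_lt_mul (Nat.succ_pos U)] at hlt
    have hMv : M / v ≤ U := by
      have : M / v < U + 1 := by
        rw [Nat.div_lt_iff_lt_mul hv0]
        simpa [mul_comm] using hlt
      omega
    rw [Finset.Ioc_eq_empty (fun h => ?_), Finset.sum_empty]
    exact absurd (lt_of_lt_of_le h hMv) (not_lt.mpr (le_max_left U (N / v)))

/-- **The window hyperbola decomposition**: for `U ≤ M`,
`Σ_{N<n≤M} Σ_{uv=n} φ(u,v) = Σ_{1≤u≤U} Σ_{N/u<v≤M/u} φ(u,v) + Σ_{1≤v≤M/(U+1)} Σ_{max(U,N/v)<u≤M/v} φ(u,v)`.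
[cite: MontgomeryVaughan2007, §2.1 (hyperbola method)] -/
theorem sum_window_conv_split {E : Type*} [AddCommMonoid E] (φ : ℕ × ℕ → E) {N M U : ℕ}
    (hU : U ≤ M) :
    ∑ n ∈ Ioc N M, ∑ p ∈ n.divisorsAntidiagonal, φ p =
      ∑ u ∈ Ioc 0 U, ∑ v ∈ Ioc (N / u) (M / u), φ (u, v) +
        ∑ v ∈ Ioc 0 (M / (U + 1)), ∑ u ∈ Ioc (max U (N / v)) (M / v), φ (u, v) := by
  rw [sum_window_conv_eq_sum_pairs, sum_pairs_eq_sum_fst, ← sum_pairs_tail_eq_sum_snd,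
    Finset.sum_Ioc_consecutive _ (Nat.zero_le U) hU]

/-! ### §B. The abstract short-window bound -/

/-- **Window sums of a Dirichlet product, `ℓ¹ × window` form** (the first step of the hyperbola
method: `Σ_{N<uv≤M} a(u)c(v) = Σ_u a(u)·Σ_{N/u<v≤M/u} c(v)`): if every window sum of `c` with
right end-point `≤ M` is `≤ C`, then `‖Σ_{N<uv≤M} a(u)c(v)‖ ≤ (Σ_{u≤M} ‖a(u)‖)·C` — the form in
which a short `ℓ¹`-head (`δ_D ⋆ υ·1_{≤D⁴}` in the cell) passes a window bound through.
[cite: MontgomeryVaughan2007, §2.1 (hyperbola method)] -/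
theorem norm_window_conv_le_l1 {a c : ℕ → ℂ} {C : ℝ} {M : ℕ}
    (hc : ∀ N' M' : ℕ, M' ≤ M → ‖∑ n ∈ Ioc N' M', c n‖ ≤ C) (N : ℕ) :
    ‖∑ n ∈ Ioc N M, ∑ p ∈ n.divisorsAntidiagonal, a p.1 * c p.2‖ ≤
      (∑ u ∈ Ioc 0 M, ‖a u‖) * C := by
  rw [sum_window_conv_eq_sum_pairs (fun p : ℕ × ℕ => a p.1 * c p.2), sum_pairs_eq_sum_fst,
    Finset.sum_mul]
  refine (norm_sum_le _ _).trans (Finset.sum_le_sum fun u _ => ?_)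
  show ‖∑ v ∈ Ioc (N / u) (M / u), a u * c v‖ ≤ ‖a u‖ * C
  rw [← Finset.mul_sum, norm_mul]
  exact mul_le_mul_of_nonneg_left (hc _ _ (Nat.div_le_self M u)) (norm_nonneg _)

/-- **Short-window hyperbola bound, parametric form**: if every window sum of `f` (right
end-point `≤ M`) is `≤ A`, every such window sum of `g` is `≤ B`, `‖f‖ ≤ S_f` and `‖g‖ ≤ S_g` on
`[1, M]`, then for all `N` and `U ≤ M`
`‖Σ_{N<uv≤M} f(u)g(v)‖ ≤ U·S_f·B + ⌊M/(U+1)⌋·S_g·A` (all hypotheses are local to `n ≤ M`).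
[cite: MontgomeryVaughan2007, §2.1 (hyperbola method) with §1.3 Thm. 1.3] -/
theorem norm_window_conv_le {f g : ℕ → ℂ} {A B Sf Sg : ℝ} {M : ℕ} (hSf : 0 ≤ Sf)
    (hA : ∀ N' M' : ℕ, M' ≤ M → ‖∑ n ∈ Ioc N' M', f n‖ ≤ A)
    (hB : ∀ N' M' : ℕ, M' ≤ M → ‖∑ n ∈ Ioc N' M', g n‖ ≤ B)
    (hf : ∀ n, n ≤ M → ‖f n‖ ≤ Sf) (hg : ∀ n, n ≤ M → ‖g n‖ ≤ Sg) (N : ℕ) {U : ℕ}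
    (hU : U ≤ M) :
    ‖∑ n ∈ Ioc N M, ∑ p ∈ n.divisorsAntidiagonal, f p.1 * g p.2‖ ≤
      U * (Sf * B) + (M / (U + 1) : ℕ) * (Sg * A) := by
  rw [sum_window_conv_split (fun p : ℕ × ℕ => f p.1 * g p.2) hU]
  refine (norm_add_le _ _).trans (add_le_add ?_ ?_)
  · calc ‖∑ u ∈ Ioc 0 U, ∑ v ∈ Ioc (N / u) (M / u), f u * g v‖
        ≤ ∑ u ∈ Ioc 0 U, ‖∑ v ∈ Ioc (N / u) (M / u), f u * g v‖ := norm_sum_le _ _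
      _ ≤ ∑ u ∈ Ioc 0 U, Sf * B := Finset.sum_le_sum fun u hu => by
          have huM : u ≤ M := (Finset.mem_Ioc.mp hu).2.trans hU
          rw [← Finset.mul_sum, norm_mul]
          exact mul_le_mul (hf u huM) (hB _ _ (Nat.div_le_self M u)) (norm_nonneg _) hSf
      _ = U * (Sf * B) := by
          rw [Finset.sum_const, Nat.card_Ioc, nsmul_eq_mul]; simp
  · calc ‖∑ v ∈ Ioc 0 (M / (U + 1)), ∑ u ∈ Ioc (max U (N / v)) (M / v), f u * g v‖
        ≤ ∑ v ∈ Ioc 0 (M / (U + 1)), ‖∑ u ∈ Ioc (max U (N / v)) (M / v), f u * g v‖ :=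
          norm_sum_le _ _
      _ ≤ ∑ v ∈ Ioc 0 (M / (U + 1)), Sg * A := Finset.sum_le_sum fun v hv => by
          have hvM : v ≤ M := (Finset.mem_Ioc.mp hv).2.trans (Nat.div_le_self M (U + 1))
          rw [← Finset.sum_mul, norm_mul, mul_comm]
          exact mul_le_mul (hg v hvM) (hA _ _ (Nat.div_le_self M v)) (norm_nonneg _)
            ((norm_nonneg _).trans (hg v hvM))
      _ = (M / (U + 1) : ℕ) * (Sg * A) := by
          rw [Finset.sum_const, Nat.card_Ioc, nsmul_eq_mul]; simp

/-- **Short-window hyperbola bound** (`U = ⌊√M⌋`): under the (local) hypotheses of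
`norm_window_conv_le`, for every `N`, `‖Σ_{N<uv≤M} f(u)g(v)‖ ≤ √M·(S_f·B + S_g·A)` — uniform in the
position and in the length of the window `(N, M]`.
[cite: MontgomeryVaughan2007, §2.1 with §1.3 Thm. 1.3] -/
theorem norm_window_conv_le_sqrt {f g : ℕ → ℂ} {A B Sf Sg : ℝ} {M : ℕ} (hA0 : 0 ≤ A) (hB0 : 0 ≤ B)
    (hSf : 0 ≤ Sf) (hSg : 0 ≤ Sg)
    (hA : ∀ N' M' : ℕ, M' ≤ M → ‖∑ n ∈ Ioc N' M', f n‖ ≤ A)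
    (hB : ∀ N' M' : ℕ, M' ≤ M → ‖∑ n ∈ Ioc N' M', g n‖ ≤ B)
    (hf : ∀ n, n ≤ M → ‖f n‖ ≤ Sf) (hg : ∀ n, n ≤ M → ‖g n‖ ≤ Sg) (N : ℕ) :
    ‖∑ n ∈ Ioc N M, ∑ p ∈ n.divisorsAntidiagonal, f p.1 * g p.2‖ ≤
      Real.sqrt M * (Sf * B + Sg * A) := by
  set U := Nat.sqrt M with hUdef
  have hU : U ≤ M := Nat.sqrt_le_self M
  have hU1 : (U : ℝ) ≤ Real.sqrt M := by
    rw [Real.le_sqrt (Nat.cast_nonneg U) (Nat.cast_nonneg M)]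
    exact_mod_cast (sq U ▸ Nat.sqrt_le' M : U ^ 2 ≤ M)
  have hU2 : ((M / (U + 1) : ℕ) : ℝ) ≤ Real.sqrt M := by
    refine le_trans ?_ hU1
    have : M / (U + 1) < U + 1 := by
      rw [Nat.div_lt_iff_lt_mul (Nat.succ_pos U)]
      exact Nat.lt_succ_sqrt M
    exact_mod_cast Nat.lt_succ_iff.mp this
  calc ‖∑ n ∈ Ioc N M, ∑ p ∈ n.divisorsAntidiagonal, f p.1 * g p.2‖
      ≤ U * (Sf * B) + (M / (U + 1) : ℕ) * (Sg * A) := norm_window_conv_le hSf hA hB hf hg N hU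
    _ ≤ Real.sqrt M * (Sf * B) + Real.sqrt M * (Sg * A) := by
        have h1 := mul_nonneg hSf hB0
        have h2 := mul_nonneg hSg hA0
        gcongr
    _ = Real.sqrt M * (Sf * B + Sg * A) := by ring

/-! ### §C. The character instance (Pólya–Vinogradov windows, bounded-variation weights) -/

section Character

variable {D : ℕ} (χ : DirichletCharacter ℂ D)

/-- A total-variation bound valid on every window with right end `≤ M` is nonnegative (empty
window). [folklore] -/
private theorem tv_bound_nonneg {G : ℕ → ℂ} {V : ℝ} {M : ℕ}
    (hV : ∀ N' M' : ℕ, M' ≤ M → ∑ n ∈ Ioo N' M', ‖G n - G (n + 1)‖ ≤ V) : 0 ≤ V := by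
  simpa using hV 0 0 (Nat.zero_le M)

/-- **The `χ`-window lemma**: for `χ` primitive mod `D ≥ 2` (in particular `χ ≠ 1`) and complex
weights `G`, `F` with `‖G‖ ≤ S_G`, `‖F‖ ≤ S_F` on `[1, M]` and total variation `≤ V_G`, `≤ V_F` on
every window inside `[1, M]` (local hypotheses: the weights need only be bounded / of bounded
variation on the range actually summed), for EVERY `N` (any position, any length of `(N, M]`):
`‖Σ_{N<uv≤M} χ(u)G(u)·χ(v)F(v)‖ ≤ √M·√D(1+log D)·(S_G(S_F+V_F) + S_F(S_G+V_G))`.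
The generator of the saving is `Σ_{n mod D} χ(n) = 0` (via Pólya–Vinogradov); no zero-free
region or exceptional-zero input. [cite: Zhang2022LandauSiegel, §7 (7.18)–(7.21) p. 15]
[cite: MontgomeryVaughan2007, §2.1, §9.4 Thm. 9.18, §1.3 Thm. 1.3] -/
theorem norm_window_chi_conv_le (hχ : χ.IsPrimitive) (hD : 2 ≤ D) {G F : ℕ → ℂ}
    {SG VG SF VF : ℝ} {M : ℕ} (hSG : 0 ≤ SG) (hSF : 0 ≤ SF)
    (hGs : ∀ n, n ≤ M → ‖G n‖ ≤ SG) (hFs : ∀ n, n ≤ M → ‖F n‖ ≤ SF)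
    (hGv : ∀ N' M' : ℕ, M' ≤ M → ∑ n ∈ Ioo N' M', ‖G n - G (n + 1)‖ ≤ VG)
    (hFv : ∀ N' M' : ℕ, M' ≤ M → ∑ n ∈ Ioo N' M', ‖F n - F (n + 1)‖ ≤ VF) (N : ℕ) :
    ‖∑ n ∈ Ioc N M, ∑ p ∈ n.divisorsAntidiagonal,
        (χ (p.1 : ZMod D) * G p.1) * (χ (p.2 : ZMod D) * F p.2)‖ ≤
      Real.sqrt M * (Real.sqrt D * (1 + Real.log D)) *
        (SG * (SF + VF) + SF * (SG + VG)) := by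
  have hPV := WindowAbelBV.pvConst_nonneg D
  have hVG := tv_bound_nonneg hGv
  have hVF := tv_bound_nonneg hFv
  have hA : ∀ N' M' : ℕ, M' ≤ M → ‖∑ n ∈ Ioc N' M', χ (n : ZMod D) * G n‖ ≤
      Real.sqrt D * (1 + Real.log D) * (SG + VG) := fun N' M' hM' =>
    WindowAbelBV.norm_sum_Ioc_chi_mul_le_of_sup_tv χ hχ hD hSG
      (fun n hn => hGs n ((Finset.mem_Ioc.mp hn).2.trans hM')) (hGv N' M' hM')
  have hB : ∀ N' M' : ℕ, M' ≤ M → ‖∑ n ∈ Ioc N' M', χ (n : ZMod D) * F n‖ ≤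
      Real.sqrt D * (1 + Real.log D) * (SF + VF) := fun N' M' hM' =>
    WindowAbelBV.norm_sum_Ioc_chi_mul_le_of_sup_tv χ hχ hD hSF
      (fun n hn => hFs n ((Finset.mem_Ioc.mp hn).2.trans hM')) (hFv N' M' hM')
  have hf : ∀ n : ℕ, n ≤ M → ‖χ (n : ZMod D) * G n‖ ≤ SG := fun n hn => by
    rw [norm_mul]
    exact (mul_le_mul (χ.norm_le_one _) (hGs n hn) (norm_nonneg _) zero_le_one).trans
      (by rw [one_mul])
  have hg : ∀ n : ℕ, n ≤ M → ‖χ (n : ZMod D) * F n‖ ≤ SF := fun n hn => by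
    rw [norm_mul]
    exact (mul_le_mul (χ.norm_le_one _) (hFs n hn) (norm_nonneg _) zero_le_one).trans
      (by rw [one_mul])
  calc ‖∑ n ∈ Ioc N M, ∑ p ∈ n.divisorsAntidiagonal,
          (χ (p.1 : ZMod D) * G p.1) * (χ (p.2 : ZMod D) * F p.2)‖
      ≤ Real.sqrt M * (SG * (Real.sqrt D * (1 + Real.log D) * (SF + VF)) +
          SF * (Real.sqrt D * (1 + Real.log D) * (SG + VG))) :=
        norm_window_conv_le_sqrt (f := fun n => χ (n : ZMod D) * G n)
          (g := fun n => χ (n : ZMod D) * F n)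
          (mul_nonneg hPV (add_nonneg hSG hVG)) (mul_nonneg hPV (add_nonneg hSF hVF))
          hSG hSF hA hB hf hg N
    _ = Real.sqrt M * (Real.sqrt D * (1 + Real.log D)) *
          (SG * (SF + VF) + SF * (SG + VG)) := by ring

/-- **The `χ`-window lemma, product form**: under the same (local) hypotheses,
`‖Σ_{N<uv≤M} χ(u)G(u)·χ(v)F(v)‖ ≤ 2√M·√D(1+log D)·(S_G+V_G)(S_F+V_F)`.
[cite: Zhang2022LandauSiegel, §7 (7.18)–(7.21) p. 15]
[cite: MontgomeryVaughan2007, §2.1, §9.4 Thm. 9.18, §1.3 Thm. 1.3] -/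
theorem norm_window_chi_conv_le' (hχ : χ.IsPrimitive) (hD : 2 ≤ D) {G F : ℕ → ℂ}
    {SG VG SF VF : ℝ} {M : ℕ} (hSG : 0 ≤ SG) (hSF : 0 ≤ SF)
    (hGs : ∀ n, n ≤ M → ‖G n‖ ≤ SG) (hFs : ∀ n, n ≤ M → ‖F n‖ ≤ SF)
    (hGv : ∀ N' M' : ℕ, M' ≤ M → ∑ n ∈ Ioo N' M', ‖G n - G (n + 1)‖ ≤ VG)
    (hFv : ∀ N' M' : ℕ, M' ≤ M → ∑ n ∈ Ioo N' M', ‖F n - F (n + 1)‖ ≤ VF) (N : ℕ) :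
    ‖∑ n ∈ Ioc N M, ∑ p ∈ n.divisorsAntidiagonal,
        (χ (p.1 : ZMod D) * G p.1) * (χ (p.2 : ZMod D) * F p.2)‖ ≤
      2 * Real.sqrt M * (Real.sqrt D * (1 + Real.log D)) * ((SG + VG) * (SF + VF)) := by
  have hPV := WindowAbelBV.pvConst_nonneg D
  have hVG := tv_bound_nonneg hGv
  have hVF := tv_bound_nonneg hFv
  refine (norm_window_chi_conv_le χ hχ hD hSG hSF hGs hFs hGv hFv N).trans ?_
  have h1 : SG * (SF + VF) + SF * (SG + VG) ≤ 2 * ((SG + VG) * (SF + VF)) := by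
    nlinarith [mul_nonneg hVG hVF, mul_nonneg hVG hSF, mul_nonneg hSG hVF,
      mul_nonneg hVG (add_nonneg hSF hVF), mul_nonneg hVF (add_nonneg hSG hVG)]
  calc Real.sqrt M * (Real.sqrt D * (1 + Real.log D)) * (SG * (SF + VF) + SF * (SG + VG))
      ≤ Real.sqrt M * (Real.sqrt D * (1 + Real.log D)) * (2 * ((SG + VG) * (SF + VF))) := by
        gcongr
    _ = 2 * Real.sqrt M * (Real.sqrt D * (1 + Real.log D)) * ((SG + VG) * (SF + VF)) := by
        ring

end Character

/-! ### §D. The coprimality side condition `(uv, k) = 1` (Möbius inside; factor `τ(k)`) -/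

/-- Multiples of `e ≥ 1` in a window: `{N < n ≤ M : e ∣ n} = e·(N/e, M/e]`. [folklore] -/
private theorem filter_dvd_Ioc_eq_image {N M e : ℕ} (he : 0 < e) :
    (Ioc N M).filter (fun n => e ∣ n) = (Ioc (N / e) (M / e)).image (fun m => e * m) := by
  ext n
  simp only [Finset.mem_filter, Finset.mem_Ioc, Finset.mem_image, Nat.div_lt_iff_lt_mul he,
    Nat.le_div_iff_mul_le he]
  constructor
  · rintro ⟨⟨hN, hM⟩, ⟨m, rfl⟩⟩
    exact ⟨m, ⟨by rwa [mul_comm] at hN, by rwa [mul_comm] at hM⟩, rfl⟩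
  · rintro ⟨m, ⟨hN, hM⟩, rfl⟩
    exact ⟨⟨by rwa [mul_comm], by rwa [mul_comm]⟩, ⟨m, rfl⟩⟩

/-- **Sum over the multiples of `e ≥ 1` in a window**:
`Σ_{N<n≤M, e∣n} c(n) = Σ_{N/e<m≤M/e} c(em)`. [folklore] -/
private theorem sum_Ioc_filter_dvd_eq {E : Type*} [AddCommMonoid E] (c : ℕ → E) {N M e : ℕ}
    (he : 0 < e) :
    ∑ n ∈ (Ioc N M).filter (fun n => e ∣ n), c n = ∑ m ∈ Ioc (N / e) (M / e), c (e * m) := by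
  rw [filter_dvd_Ioc_eq_image he, Finset.sum_image]
  intro a _ b _ h
  exact (Nat.mul_right_inj he.ne').mp h

/-- For `k ≠ 0`: the divisors of `gcd(n,k)` are the divisors of `k` dividing `n`. [folklore] -/
private theorem gcd_divisors_eq_filter {n k : ℕ} (hk : k ≠ 0) :
    (Nat.gcd n k).divisors = k.divisors.filter (fun d => d ∣ n) := by
  ext d
  simp only [Nat.mem_divisors, Finset.mem_filter, Nat.dvd_gcd_iff, ne_eq, Nat.gcd_eq_zero_iff,
    not_and]
  constructor
  · rintro ⟨⟨hdn, hdk⟩, -⟩; exact ⟨⟨hdk, hk⟩, hdn⟩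
  · rintro ⟨⟨hdk, -⟩, hdn⟩; exact ⟨⟨hdn, hdk⟩, fun _ => hk⟩

section Coprime

variable {D : ℕ} (χ : DirichletCharacter ℂ D)

/-- **Character sums over a window with a coprimality condition**: for `χ` primitive mod `D ≥ 2`,
`k ≥ 1` and every window `(N, M]`,
`‖Σ_{N<n≤M, (n,k)=1} χ(n)‖ ≤ τ(k)·√D(1+log D)`
(Möbius inversion of the condition `(n,k) = 1`, then Pólya–Vinogradov on each progression
`e ∣ n`, `e ∣ k`, using `χ(em) = χ(e)χ(m)`).
[cite: MontgomeryVaughan2007, §9.4 Thm. 9.18] -/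
theorem norm_window_chi_coprime_le (hχ : χ.IsPrimitive) (hD : 2 ≤ D) {k : ℕ} (hk : k ≠ 0)
    (N M : ℕ) :
    ‖∑ n ∈ (Ioc N M).filter (fun n => n.Coprime k), χ (n : ZMod D)‖ ≤
      (k.divisors.card : ℝ) * (Real.sqrt D * (1 + Real.log D)) := by
  classical
  have hPV := WindowAbelBV.pvConst_nonneg D
  -- Möbius inversion of the coprimality condition
  have h1 : ∑ n ∈ (Ioc N M).filter (fun n => n.Coprime k), χ (n : ZMod D) =
      ∑ e ∈ k.divisors, (ArithmeticFunction.moebius e : ℂ) *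
        ∑ n ∈ (Ioc N M).filter (fun n => e ∣ n), χ (n : ZMod D) := by
    rw [Finset.sum_filter]
    have : ∀ n ∈ Ioc N M, (if n.Coprime k then χ (n : ZMod D) else 0) =
        ∑ e ∈ k.divisors, if e ∣ n then (ArithmeticFunction.moebius e : ℂ) * χ (n : ZMod D)
          else 0 := by
      intro n _
      rw [← Finset.sum_filter, ← gcd_divisors_eq_filter hk, ← Finset.sum_mul,
        ← Sieve.MontgomeryVaughan1975.coprime_indicator_eq_sum_moebius n k]
      split_ifs <;> simp
    rw [Finset.sum_congr rfl this, Finset.sum_comm]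
    refine Finset.sum_congr rfl fun e _ => ?_
    rw [Finset.sum_filter, Finset.mul_sum]
    refine Finset.sum_congr rfl fun n _ => ?_
    split_ifs <;> simp
  rw [h1]
  calc ‖∑ e ∈ k.divisors, (ArithmeticFunction.moebius e : ℂ) *
          ∑ n ∈ (Ioc N M).filter (fun n => e ∣ n), χ (n : ZMod D)‖
      ≤ ∑ e ∈ k.divisors, ‖(ArithmeticFunction.moebius e : ℂ) *
          ∑ n ∈ (Ioc N M).filter (fun n => e ∣ n), χ (n : ZMod D)‖ := norm_sum_le _ _
    _ ≤ ∑ e ∈ k.divisors, Real.sqrt D * (1 + Real.log D) := by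
        refine Finset.sum_le_sum fun e he => ?_
        have he0 : 0 < e := Nat.pos_of_mem_divisors he
        rw [norm_mul, sum_Ioc_filter_dvd_eq _ he0]
        have hμ : ‖(ArithmeticFunction.moebius e : ℂ)‖ ≤ 1 := by
          rw [Complex.norm_intCast]
          exact_mod_cast ArithmeticFunction.abs_moebius_le_one
        have hχe : ‖∑ m ∈ Ioc (N / e) (M / e), χ ((e * m : ℕ) : ZMod D)‖ ≤
            Real.sqrt D * (1 + Real.log D) := by
          have : ∑ m ∈ Ioc (N / e) (M / e), χ ((e * m : ℕ) : ZMod D) =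
              χ (e : ZMod D) * ∑ m ∈ Ioc (N / e) (M / e), χ (m : ZMod D) := by
            rw [Finset.mul_sum]
            refine Finset.sum_congr rfl fun m _ => ?_
            rw [Nat.cast_mul, map_mul]
          rw [this, norm_mul]
          exact (mul_le_mul (χ.norm_le_one _)
            (CharacterTails.norm_window_le_polyaVinogradov χ hχ hD _ _) (norm_nonneg _)
            zero_le_one).trans (by rw [one_mul])
        exact (mul_le_mul hμ hχe (norm_nonneg _) zero_le_one).trans (by rw [one_mul])
    _ = (k.divisors.card : ℝ) * (Real.sqrt D * (1 + Real.log D)) := by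
        rw [Finset.sum_const, nsmul_eq_mul]

/-- **The `χ`-window lemma with the side condition `(uv, k) = 1`** (the slot shape
`ChiWindowBound` of the cell's record, ls-knife-crit-1 2026-08-27T17:22:01Z): for `χ` primitive
mod `D ≥ 2`, `k ≥ 1`, weights `G`, `F` as in `norm_window_chi_conv_le` (local hypotheses on
`[1, M]`), and EVERY `N`,
`‖Σ_{N<uv≤M, (uv,k)=1} χ(u)G(u)·χ(v)F(v)‖ ≤ τ(k)·√M·√D(1+log D)·(S_G(S_F+V_F) + S_F(S_G+V_G))`,
`τ(k) = #(divisors of k)`: the condition `(uv,k)=1` factors as `(u,k)=1 ∧ (v,k)=1`, each factor's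
window sums are bounded by `norm_window_chi_coprime_le` and Abel summation
(`WindowAbelBV.norm_sum_Ioc_mul_le_of_sup_tv`), and §B applies.
[cite: Zhang2022LandauSiegel, §7 (7.18)–(7.21) p. 15]
[cite: MontgomeryVaughan2007, §2.1, §9.4 Thm. 9.18, §1.3 Thm. 1.3] -/
theorem norm_window_chi_conv_coprime_le (hχ : χ.IsPrimitive) (hD : 2 ≤ D) {k : ℕ} (hk : k ≠ 0)
    {G F : ℕ → ℂ} {SG VG SF VF : ℝ} {M : ℕ} (hSG : 0 ≤ SG) (hSF : 0 ≤ SF)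
    (hGs : ∀ n, n ≤ M → ‖G n‖ ≤ SG) (hFs : ∀ n, n ≤ M → ‖F n‖ ≤ SF)
    (hGv : ∀ N' M' : ℕ, M' ≤ M → ∑ n ∈ Ioo N' M', ‖G n - G (n + 1)‖ ≤ VG)
    (hFv : ∀ N' M' : ℕ, M' ≤ M → ∑ n ∈ Ioo N' M', ‖F n - F (n + 1)‖ ≤ VF) (N : ℕ) :
    ‖∑ n ∈ (Ioc N M).filter (fun n => n.Coprime k), ∑ p ∈ n.divisorsAntidiagonal,
        (χ (p.1 : ZMod D) * G p.1) * (χ (p.2 : ZMod D) * F p.2)‖ ≤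
      (k.divisors.card : ℝ) * Real.sqrt M * (Real.sqrt D * (1 + Real.log D)) *
        (SG * (SF + VF) + SF * (SG + VG)) := by
  classical
  have hPV := WindowAbelBV.pvConst_nonneg D
  have hVG := tv_bound_nonneg hGv
  have hVF := tv_bound_nonneg hFv
  have hτ : (0 : ℝ) ≤ k.divisors.card := Nat.cast_nonneg _
  -- the two factors with the coprimality indicator inside
  set f : ℕ → ℂ := fun u => (if u.Coprime k then χ (u : ZMod D) else 0) * G u with hfdef
  set g : ℕ → ℂ := fun v => (if v.Coprime k then χ (v : ZMod D) else 0) * F v with hgdef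
  -- Step 1: the restricted convolution is the full convolution of `f` and `g`
  have hconv : ∑ n ∈ (Ioc N M).filter (fun n => n.Coprime k), ∑ p ∈ n.divisorsAntidiagonal,
        (χ (p.1 : ZMod D) * G p.1) * (χ (p.2 : ZMod D) * F p.2) =
      ∑ n ∈ Ioc N M, ∑ p ∈ n.divisorsAntidiagonal, f p.1 * g p.2 := by
    rw [Finset.sum_filter]
    refine Finset.sum_congr rfl fun n _ => ?_
    split_ifs with hc
    · refine Finset.sum_congr rfl fun p hp => ?_
      have hn : p.1 * p.2 = n := (Nat.mem_divisorsAntidiagonal.mp hp).1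
      rw [← hn, Nat.coprime_mul_iff_left] at hc
      simp only [hfdef, hgdef, if_pos hc.1, if_pos hc.2]
    · symm
      refine Finset.sum_eq_zero fun p hp => ?_
      have hn : p.1 * p.2 = n := (Nat.mem_divisorsAntidiagonal.mp hp).1
      rw [← hn, Nat.coprime_mul_iff_left, not_and_or] at hc
      rcases hc with h1 | h2
      · simp [hfdef, h1]
      · simp [hgdef, h2]
  -- Step 2: window sums and sup norms of `f` and `g`
  have hWk : ∀ N' n : ℕ, ‖∑ j ∈ Ioc N' n, (if j.Coprime k then χ (j : ZMod D) else 0)‖ ≤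
      (k.divisors.card : ℝ) * (Real.sqrt D * (1 + Real.log D)) := fun N' n => by
    rw [← Finset.sum_filter]
    exact norm_window_chi_coprime_le χ hχ hD hk N' n
  have hA : ∀ N' M' : ℕ, M' ≤ M → ‖∑ n ∈ Ioc N' M', f n‖ ≤
      (k.divisors.card : ℝ) * (Real.sqrt D * (1 + Real.log D)) * (SG + VG) := fun N' M' hM' =>
    WindowAbelBV.norm_sum_Ioc_mul_le_of_sup_tv (mul_nonneg hτ hPV) (fun n _ => hWk N' n) hSG
      (fun n hn => hGs n ((Finset.mem_Ioc.mp hn).2.trans hM')) (hGv N' M' hM')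
  have hB : ∀ N' M' : ℕ, M' ≤ M → ‖∑ n ∈ Ioc N' M', g n‖ ≤
      (k.divisors.card : ℝ) * (Real.sqrt D * (1 + Real.log D)) * (SF + VF) := fun N' M' hM' =>
    WindowAbelBV.norm_sum_Ioc_mul_le_of_sup_tv (mul_nonneg hτ hPV) (fun n _ => hWk N' n) hSF
      (fun n hn => hFs n ((Finset.mem_Ioc.mp hn).2.trans hM')) (hFv N' M' hM')
  have hind : ∀ n : ℕ, ‖(if n.Coprime k then χ (n : ZMod D) else 0)‖ ≤ 1 := fun n => by
    split_ifs
    · exact χ.norm_le_one _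
    · simp
  have hf : ∀ n : ℕ, n ≤ M → ‖f n‖ ≤ SG := fun n hn => by
    simp only [hfdef]; rw [norm_mul]
    exact (mul_le_mul (hind n) (hGs n hn) (norm_nonneg _) zero_le_one).trans (by rw [one_mul])
  have hg : ∀ n : ℕ, n ≤ M → ‖g n‖ ≤ SF := fun n hn => by
    simp only [hgdef]; rw [norm_mul]
    exact (mul_le_mul (hind n) (hFs n hn) (norm_nonneg _) zero_le_one).trans (by rw [one_mul])
  rw [hconv]
  calc ‖∑ n ∈ Ioc N M, ∑ p ∈ n.divisorsAntidiagonal, f p.1 * g p.2‖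
      ≤ Real.sqrt M *
          (SG * ((k.divisors.card : ℝ) * (Real.sqrt D * (1 + Real.log D)) * (SF + VF)) +
            SF * ((k.divisors.card : ℝ) * (Real.sqrt D * (1 + Real.log D)) * (SG + VG))) :=
        norm_window_conv_le_sqrt
          (mul_nonneg (mul_nonneg hτ hPV) (add_nonneg hSG hVG))
          (mul_nonneg (mul_nonneg hτ hPV) (add_nonneg hSF hVF)) hSG hSF hA hB hf hg N
    _ = (k.divisors.card : ℝ) * Real.sqrt M * (Real.sqrt D * (1 + Real.log D)) *
          (SG * (SF + VF) + SF * (SG + VG)) := by ring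

end Coprime

/-! ### §E. An `ℓ¹` head under the side condition; the assembled three-factor bound

The cell's datum is a triple product `b ⋆ (χG) ⋆ (χF)` with a short `ℓ¹` head `b`
(`KnifeEdgeLenLongLegSplit.longPsiData`); under the side condition `(n,k) = 1` the head passes
through exactly as in `norm_window_conv_le_l1`, because `(e·m, k) = 1 ⇔ (e,k) = 1 ∧ (m,k) = 1`. -/

/-- For every `C` bounding some norm, `0 ≤ C`. [folklore] -/
private theorem nonneg_of_window_bound {c : ℕ → ℂ} {C : ℝ} {M : ℕ} {P : ℕ → Prop}
    [DecidablePred P]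
    (hc : ∀ N' M' : ℕ, M' ≤ M → ‖∑ n ∈ (Ioc N' M').filter P, c n‖ ≤ C) : 0 ≤ C := by
  have h := hc 0 0 (Nat.zero_le _)
  simp only [Finset.Ioc_self, Finset.filter_empty, Finset.sum_empty, norm_zero] at h
  exact h

/-- **`ℓ¹ × window` form under the side condition `(n,k) = 1`**: if every window sum of `c`
restricted to `(v,k) = 1`, with right end-point `≤ M`, is `≤ C`, then
`‖Σ_{N<uv≤M, (uv,k)=1} a(u)c(v)‖ ≤ (Σ_{u≤M} ‖a(u)‖)·C`
(the terms with `(u,k) ≠ 1` vanish and are bounded by `‖a(u)‖·C` anyway).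
[cite: MontgomeryVaughan2007, §2.1 (hyperbola method)] -/
theorem norm_window_conv_coprime_le_l1 {a c : ℕ → ℂ} {C : ℝ} {M k : ℕ}
    (hc : ∀ N' M' : ℕ, M' ≤ M →
      ‖∑ n ∈ (Ioc N' M').filter (fun n => n.Coprime k), c n‖ ≤ C) (N : ℕ) :
    ‖∑ n ∈ (Ioc N M).filter (fun n => n.Coprime k), ∑ p ∈ n.divisorsAntidiagonal,
        a p.1 * c p.2‖ ≤ (∑ u ∈ Ioc 0 M, ‖a u‖) * C := by
  classical
  have hC : 0 ≤ C := nonneg_of_window_bound hc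
  set a' : ℕ → ℂ := fun u => if u.Coprime k then a u else 0 with ha'
  set c' : ℕ → ℂ := fun v => if v.Coprime k then c v else 0 with hc'
  -- the restricted convolution is the full convolution of `a'` and `c'`
  have hconv : ∑ n ∈ (Ioc N M).filter (fun n => n.Coprime k), ∑ p ∈ n.divisorsAntidiagonal,
        a p.1 * c p.2 = ∑ n ∈ Ioc N M, ∑ p ∈ n.divisorsAntidiagonal, a' p.1 * c' p.2 := by
    rw [Finset.sum_filter]
    refine Finset.sum_congr rfl fun n _ => ?_
    split_ifs with hk
    · refine Finset.sum_congr rfl fun p hp => ?_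
      have hn : p.1 * p.2 = n := (Nat.mem_divisorsAntidiagonal.mp hp).1
      rw [← hn, Nat.coprime_mul_iff_left] at hk
      simp only [ha', hc', if_pos hk.1, if_pos hk.2]
    · symm
      refine Finset.sum_eq_zero fun p hp => ?_
      have hn : p.1 * p.2 = n := (Nat.mem_divisorsAntidiagonal.mp hp).1
      rw [← hn, Nat.coprime_mul_iff_left, not_and_or] at hk
      rcases hk with h1 | h2
      · simp [ha', h1]
      · simp [hc', h2]
  have hcw : ∀ N' M' : ℕ, M' ≤ M → ‖∑ n ∈ Ioc N' M', c' n‖ ≤ C := fun N' M' hM' => by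
    rw [← Finset.sum_filter]
    exact hc N' M' hM'
  have ha : ∀ u : ℕ, ‖a' u‖ ≤ ‖a u‖ := fun u => by
    simp only [ha']
    split_ifs
    · exact le_rfl
    · rw [norm_zero]; exact norm_nonneg _
  rw [hconv]
  exact (norm_window_conv_le_l1 hcw N).trans
    (mul_le_mul_of_nonneg_right (Finset.sum_le_sum fun u _ => ha u) hC)

section Assembled

variable {D : ℕ} (χ : DirichletCharacter ℂ D)

/-- **The assembled bound for a datum `b ⋆ (χG) ⋆ (χF)` with the side condition `(n,k) = 1`**
(the shape of `KnifeEdgeLenLongLegSplit.longPsiData χ b g f` with `G(m) = g(log m/log P)`,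
`F(m) = f(log m/log P)`): for `χ` primitive mod `D ≥ 2`, `k ≥ 1`, weights `G, F` bounded and of
bounded variation on `[1, M]`, and EVERY `N`,
`‖Σ_{N<n≤M, (n,k)=1} (b ⋆ χG ⋆ χF)(n)‖ ≤ (Σ_{e≤M} ‖b(e)‖)·τ(k)·√M·√D(1+log D)·(S_G(S_F+V_F)+S_F(S_G+V_G))`.
[cite: Zhang2022LandauSiegel, §8 Lemma 8.1, (8.8); §7 (7.18)–(7.21) p. 15]
[cite: MontgomeryVaughan2007, §2.1, §9.4 Thm. 9.18, §1.3 Thm. 1.3] -/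
theorem norm_window_head_chi_conv_coprime_le (hχ : χ.IsPrimitive) (hD : 2 ≤ D) {k : ℕ}
    (hk : k ≠ 0) {b G F : ℕ → ℂ} {SG VG SF VF : ℝ} {M : ℕ} (hSG : 0 ≤ SG) (hSF : 0 ≤ SF)
    (hGs : ∀ n, n ≤ M → ‖G n‖ ≤ SG) (hFs : ∀ n, n ≤ M → ‖F n‖ ≤ SF)
    (hGv : ∀ N' M' : ℕ, M' ≤ M → ∑ n ∈ Ioo N' M', ‖G n - G (n + 1)‖ ≤ VG)
    (hFv : ∀ N' M' : ℕ, M' ≤ M → ∑ n ∈ Ioo N' M', ‖F n - F (n + 1)‖ ≤ VF) (N : ℕ) :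
    ‖∑ n ∈ (Ioc N M).filter (fun n => n.Coprime k), ∑ p ∈ n.divisorsAntidiagonal,
        b p.1 * ∑ q ∈ p.2.divisorsAntidiagonal,
          (χ (q.1 : ZMod D) * G q.1) * (χ (q.2 : ZMod D) * F q.2)‖ ≤
      (∑ e ∈ Ioc 0 M, ‖b e‖) *
        ((k.divisors.card : ℝ) * Real.sqrt M * (Real.sqrt D * (1 + Real.log D)) *
          (SG * (SF + VF) + SF * (SG + VG))) := by
  have hPV := WindowAbelBV.pvConst_nonneg D
  have hVG := tv_bound_nonneg hGv
  have hVF := tv_bound_nonneg hFv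
  have hτ : (0 : ℝ) ≤ k.divisors.card := Nat.cast_nonneg _
  have hK : 0 ≤ SG * (SF + VF) + SF * (SG + VG) :=
    add_nonneg (mul_nonneg hSG (add_nonneg hSF hVF)) (mul_nonneg hSF (add_nonneg hSG hVG))
  -- every inner window `(N', M']` with `M' ≤ M`: the `χ`-window lemma at `M'`, then `√M' ≤ √M`
  have hcw : ∀ N' M' : ℕ, M' ≤ M →
      ‖∑ n ∈ (Ioc N' M').filter (fun n => n.Coprime k), ∑ q ∈ n.divisorsAntidiagonal,
          (χ (q.1 : ZMod D) * G q.1) * (χ (q.2 : ZMod D) * F q.2)‖ ≤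
        (k.divisors.card : ℝ) * Real.sqrt M * (Real.sqrt D * (1 + Real.log D)) *
          (SG * (SF + VF) + SF * (SG + VG)) := by
    intro N' M' hM'
    have hM'r : Real.sqrt (M' : ℝ) ≤ Real.sqrt (M : ℝ) :=
      Real.sqrt_le_sqrt (by exact_mod_cast hM')
    refine (norm_window_chi_conv_coprime_le χ hχ hD hk hSG hSF
      (fun n hn => hGs n (hn.trans hM')) (fun n hn => hFs n (hn.trans hM'))
      (fun N'' M'' hM'' => hGv N'' M'' (hM''.trans hM'))
      (fun N'' M'' hM'' => hFv N'' M'' (hM''.trans hM')) N').trans ?_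
    exact mul_le_mul_of_nonneg_right
      (mul_le_mul_of_nonneg_right (mul_le_mul_of_nonneg_left hM'r hτ) hPV) hK
  exact norm_window_conv_coprime_le_l1 (a := b)
    (c := fun m => ∑ q ∈ m.divisorsAntidiagonal,
      (χ (q.1 : ZMod D) * G q.1) * (χ (q.2 : ZMod D) * F q.2)) hcw N

end Assembled

end Literature.NumberTheory.LFunctions.Zhang2022.WindowHyperbola

end
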